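import Mathlib
import HarnessLib
import HarnessLib.Audit
import Summits.PneNP.Statement
import Literature.Computability.Complexity.Classes
import Literature.Computability.Complexity.Nondeterministic
import Literature.Computability.MetaComplexity.DistProblems
import Literature.Computability.MetaComplexity.UniversalMachine
import Literature.Computability.Cryptography.CryptoFoundationsKolmogorov
import Literature.Computability.Cryptography.OneWayFunctions
import Literature.Computability.Complexity.SearchToDecision
import Literature.Computability.Complexity.RandomizedProofs
import Literature.Computability.Complexity.NPBridge
import Literature.Computability.Complexity.ClayProblem
import HarnessLib.Audit.Status.Attr

/-!
Route: MetaCplx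

DORMANT since 2026-08-23T00:12:31Z (reconciler: no traction for 5.8 d (last activity item-evidence-added at 2026-08-17T04:52:04Z); parked, not closed — `ledger route dormant route-PneNP-MetaCplx --off` to reactivate) — unstaffed, not closed; items shared with open routes are served there. `ledger route dormant <id> --off` reactivates.

# Route PneNP/MetaCplx — "one-way functions exist, because time-bounded Kolmogorov complexity is
hard on average"

## Thesis X (it suffices to show)
Words: one-way functions exist (Goldreich 2001, Def. 2.2.1): some polynomial-time f that every PPT
algorithm inverts
with negligible probability. By Liu–Pass 2020, Thm 1.1 (tree theorem
`OWFExist_iff_isMildlyHardOnAverage_liuPassKt_holds`)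
this is the same as mild average-case hardness of the t-time-bounded Kolmogorov complexity K^t.
Lean: `∃ f : List Bool → List Bool, Literature.Computability.Cryptography.IsOneWay f`
(= `Literature.Computability.Cryptography.OWFExist` by `Iff.rfl`; typed unfolded so that no
cite-tagged conjecture constant sits in
the route's dependency cone — the conjecture IS the target, not a fact the route leans on.)

## Deciding theorem X → PneNP (D-0027 §2.1)
`theorem closes (hX : MetacplxThesis) : _root_.PneNP` — proved in the route file from tree theorems
only (no named-fact
hypotheses): Goldreich 2001 §2.7.4 Exercise 2 (if NP ⊆ P, search-to-decision
`exists_inverter_of_NP_subset_P` gives every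
f ∈ FP a polynomial-time sure inverter, whose coin-free PPT version `RandAlg.ofDet` inverts with
probability 1 —
`RandAlg.IsPolyTime.ofDet_holds`, `RandAlg.pr_ofDet` — contradicting negligibility), then the proved
model bridges
`P_bool_eq_holds : PNPWave0.P Bool = Classes.P` and `np_bool_eq : PNPWave0.NP Bool =
Nondeterministic.NP` rewrite
¬ (NP ⊆ P) into Cook's `∃ L ∈ NP Bool, L ∉ P Bool`. (The `Assembly` item, which used to list the
named facts
P_ne_NP_of_OWFExist / P_bool_eq / NP_bool_eq / P_subset_NP as hypotheses, is restated as
`MetacplxThesis → _root_.PneNP`: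
hypotheses ⊆ items, conclusion = the Statement, provable now as `fun hX => closes hX`.)

## Why this line (widen: information theory / Kolmogorov complexity, average-case analysis)
Liu–Pass [LiuPassFOCS2020, Thm 1.1] make X EQUIVALENT to a statement about a single natural
function: K^t, the
t-time-bounded Kolmogorov complexity, is mildly hard on average for some/every polynomial t ≥
(1+ε)n. This moves P ≠ NP's
cryptographic strengthening onto information-theoretic ground (incompressibility, coding/counting
arguments, symmetry of
information), where Hirahara's non-black-box worst-case↔average-case reductions live [STOC2021, Thm
1.6 =
`hirahara_UP_DistNP`], and connects to Krajíček's generator conjecture (route ProofCplx) through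
K^t. Impagliazzo's
worlds [CCC1995] give the ladder: X = ¬Pessiland ∧ ¬Heuristica ∧ P≠NP; the cruxes below are exactly
those rungs, all
typed over Literature definitions (OneWayFunctions, CryptoFoundationsKolmogorov, UniversalMachine,
DistProblems).

## Ranked cruxes
- #2 (hardest / most informative) `MetacplxKtMildlyHoa`: K^t is mildly hard on average at t(n) = 2n,
for every
  admissible universal machine:
  `∀ U : Literature.Computability.MetaComplexity.UniversalMachine,
Literature.Computability.Cryptography.IsMildlyHardOnAverage Computability.encodeNat
(Literature.Computability.Cryptography.liuPassKt U (2 * Polynomial.X))`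
  (↔ X per U by the tree theorem `OWFExist_iff_isMildlyHardOnAverage_liuPassKt_holds`, ε = 1; ∀U not
vacuous by
  `UniversalMachine.nonempty_holds`).
- #3 `MetacplxNoHeuristica`, no Heuristica: `¬ Literature.Computability.MetaComplexity.DistNP ⊆
Literature.Computability.MetaComplexity.AvgP`
  (necessary for X; already ⇒ P ≠ NP via `distClass_P_subset_AvgP_holds`; reachable from UP ⊄
DTIME(2^{O(n/log n)}) by
  `hirahara_UP_DistNP`).
- #4 `MetacplxNoPessiland`, no Pessiland — the bridge #3 → X (Impagliazzo 1995 §4, open), typed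
UNFOLDED so the route
  imports no crypto sweep file and names no conjecture constant: `¬
(Literature.Computability.MetaComplexity.DistNP ⊆ Literature.Computability.MetaComplexity.AvgP) → ∃
f : List Bool → List Bool, Literature.Computability.Cryptography.IsOneWay f`
  (= `Literature.Computability.Cryptography.NoPessiland` by `Iff.rfl`; conclusion = #0 verbatim).
- #5 `MetacplxMinktNotInP`, worst-case shadow: `∀ U :
Literature.Computability.MetaComplexity.UniversalMachine, U.MINKT ∉
Literature.Computability.Complexity.Classes.P`
  (Ko 1991; implied by X; with MINKT ∈ NP it alone gives P ≠ NP — the weakest typed statement on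
this line).
Formal links between items: #2 ↔ #0 (tree theorem), #3 ∧ #4 → #0 (definition of #4), #0 → #5
(Liu–Pass §2.2),
#0 → PneNP (`closes`).

## Import cone (route-repair 2026-08-15)
Imports are cut to Classes, Nondeterministic, DistProblems, UniversalMachine,
CryptoFoundationsKolmogorov,
OneWayFunctions (+ SearchToDecision, RandomizedProofs, NPBridge, ClayProblem for `closes`). The
residual unproved
"facts" of the FILE-import cone are five OPEN CONJECTURES, none of them a dependency of any item or
of `closes`:
OWFExist (= the target X, which the items spell out as `∃ f, IsOneWay f`), its siblings IOOWFExist /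
WeakOWFExist /
NonuniformOWFExist (same file as IsOneWay; each implies P ≠ NP, OneWayFunctionsPneNP.lean), and
NPNotSubsetPPoly
(ClayProblem.lean, `[status: open]`, co-located with the model bridge every PneNP route needs). The
CONSTANT cone of the
route's declarations (`#h21_route_deps`) contains no unproved named fact at all. needs-fact: none.

## Kill criteria
- ¬X (no OWF) closes the route but not the problem; #3 and #5 survive as a NoHeuristica route
(re-open under that name).
- A proof that DistNP ⊆ AvgP (Heuristica exists relative to nothing) kills #3 and, with it, the
whole line.
- #2 refuted for one admissible U ⇒ X refuted (the ↔ is a tree theorem per U) ⇒ close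
refuted:MetacplxKtMildlyHoa.

## Deliberately NOT decomposed yet
Which t (any (1+ε)n ≤ t ≤ poly suffices); MCSP/MKTP variants and Hirahara's partial-MCSP NP-hardness
[Hirahara2022];
symmetry-of-information approaches; probabilistic K^t (pK^t) and its coding-theorem route to OWF;
the UP ⊄ DTIME(2^{O(n/log n)})
feeder of #3.
Sources: LiuPassFOCS2020 (arXiv:2009.11514); Goldreich2001; CCC1995; BogdanovTrevisan2006; STOC2021;
Ko1991; Hirahara2018;
Hirahara2022; Impagliazzo2011; Wee2006.

Rationale: WHY THIS LINE. Liu–Pass (LiuPassFOCS2020, arXiv:2009.11514, Thm 1.1; tree theorem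
OWFExist_iff_isMildlyHardOnAverage_liuPassKt_holds) make the thesis X = "one-way functions exist"
equivalent to a statement about one natural function: the t-time-bounded Kolmogorov complexity K^t
is mildly hard on average for polynomial t ≥ (1+ε)n. That imports information theory / Kolmogorov
complexity and average-case complexity (Impagliazzo's five worlds, CCC1995; Bogdanov–Trevisan 2006)
into P vs NP: X = ¬Pessiland ∧ ¬Heuristica ∧ P≠NP, and the meta-complexity of K^t is the one place
where non-black-box, non-relativizing worst-case↔average-case techniques currently exist
(Hirahara2018; STOC2021 Thm 1.6 = tree fact hirahara_UP_DistNP; Hirahara2023). The deciding theorem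
X → PneNP is proved in the route file (Goldreich2001 §2.7.4 Ex. 2 via
exists_inverter_of_NP_subset_P, RandAlg.IsPolyTime.ofDet_holds, and the model bridges
P_bool_eq_holds / np_bool_eq). No other PneNP route attacks the cryptographic/average-case side;
every rung is typed over existing Literature definitions (OneWayFunctions,
CryptoFoundationsKolmogorov, UniversalMachine, DistProblems).

RANKED CRUXES. #2 MetacplxKtMildlyHoa — for every admissible universal machine U, no PPT algorithm
computes x ↦ K_U^{2|x|}(x) on a 1 − 1/p(n) fraction of uniform x (why it might fail: ↔ X per U is a
tree theorem, so it fails iff OWFs do not exist — Heuristica/Pessiland oracles Impagliazzo2011,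
Wee2006; needs a non-relativizing, non-black-box proof; sources LiuPassFOCS2020 Thm 1.1/Def 2.3,
BrzuskaCouteau2024). #3 MetacplxNoHeuristica — ¬ DistNP ⊆ AvgP (why: Impagliazzo2011's oracle
realises Heuristica; non-adaptive black-box worst-to-average reductions force coNP ⊆ AM/poly,
Bogdanov–Trevisan 2006 / AkaviaEtAl2006 Thm 4; the non-black-box feeder hirahara_UP_DistNP needs UP
⊄ DTIME(2^{O(n/log n)}); sources CCC1995, STOC2021, ChenHiraharaVafa2022). #4 MetacplxNoPessiland —
¬ DistNP ⊆ AvgP → ∃ f, IsOneWay f, Impagliazzo's open exclusion of Pessiland, typed unfolded (=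
Literature NoPessiland by Iff.rfl; conclusion = #0 verbatim) so no crypto sweep file is imported
(why: Wee2006's oracle realises Pessiland; only PH-Pessiland is excluded, HiraharaSanthanam2022;
sources CCC1995 §4, HiraharaNanashima2026, Hirahara2023). #5 MetacplxMinktNotInP — ∀U, MINKT_U ∉ P
(why: false iff MINKT_U ∈ P for one admissible U, e.g. if P = NP; NP-hardness of MINKT open since
Ko1991 and must be non-relativizing; sources Ko1991, Hirahara2018, HiraharaSanthanam2022 p.2).
Target #0 MetacplxThesis = ∃ f, IsOneWay f (= OWFExist by Iff.rfl, spelled out so the route's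
dependency cone carries no cite-tagged conjecture constant). Formal links: #2 ↔ #0 (tree theorem),
#3 ∧ #4 → #0 (definition of #4), #0 → #5 (Liu–Pass §2.2), #0 → PneNP (deciding theorem `closes`,
certified).

KILL CRITERIA. ¬#0 (one-way functions do not exist) refutes the thesis: close --reason
refuted:MetacplxThesis; #3 and #5 survive as a separate NoHeuristica line. A proof of DistNP ⊆ AvgP
refutes #3 and with it #2 and #0 (OWF ⇒ ¬Heuristica): close. #2 refuted for a single admissible U
refutes #0 by the tree ↔: close refuted:MetacplxKtMildlyHoa. #5 refuted for some admissible U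
(MINKT_U ∈ P) forces a pivot: re-audit the UniversalMachine interface (one-U vs all-U;
refuter-refute-A-1 found no degenerate U) before closing. A proof of NP ⊆ BPP anywhere moots the
line (NP_not_subset_BPP_of_OWFExist_holds).

NOT DECOMPOSED YET. Which time bound t (any (1+ε)n ≤ t ≤ poly suffices for the ↔); MCSP/MKTP
variants and Hirahara's partial-MCSP NP-hardness (Hirahara2022); symmetry-of-information approaches
to #2; probabilistic K^t (pK^t) and its coding-theorem route to OWF; the UP ⊄ DTIME(2^{O(n/log n)})
feeder of #3 via hirahara_UP_DistNP; Hirahara2023's characterisation of OWF by NP-hardness of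
distributional K^poly as an alternative bridge for #4. These are layer-2 children (glued splits, k ≤
3) once a crux moves — nothing filed now.

CHEAPEST FALSIFIER. Exhibit, for the tree's reference admissible UniversalMachine
(UniversalMachine.nonempty_holds), a PPT algorithm that outputs K_U^{2|x|}(x) on a 1 − 1/n² fraction
of x ∈ {0,1}^n — this kills #2 and, through the tree ↔, the thesis; the refuter's interface/vacuity
audit (refuter-refute-A-1: no junk U, IsPPT satisfiable, no cheap inverter) already ran the
degenerate versions and found nothing. Second cheapest: a relativization check — any proposed proof
of #2/#3/#4/#5 that survives relative to the oracles of Impagliazzo2011 / Wee2006 / Ko1991 is void,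
so a proof sketch is first tested against those oracles.

Novelty: NOVELTY (searched: lit search/frontier on "one-way functions / time-bounded Kolmogorov complexity /
Pessiland / Heuristica", local store + crossref, 2026-08-14).
Nearest prior art — the route IS the meta-complexity programme of Liu–Pass and Hirahara, restated as
a staffed ladder:
- LiuPassFOCS2020 (arXiv:2009.11514), Thm 1.1: OWF ⟺ K^t mildly hard on average for every polynomial
t(n) ≥ (1+ε)n — this is crux #2 ⟺ X verbatim (tree fact
OWFExist_iff_isMildlyHardOnAverage_liuPassKt); its 2026 sequel (Liu–Pass, ITCS 2026,
doi:10.4230/lipics.itcs.2026.97, boundary hardness of randomized K^t; not held, acq-00690) refines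
the same equivalence.
- Impagliazzo's five worlds (CCC1995; relativized Heuristica Impagliazzo2011, relativized Pessiland
Wee2006): cruxes #3 (no Heuristica) and #4 (no Pessiland) are exactly the two open exclusions;
Hirahara2023 (STOC 2023) already "captures" both by NP-hardness of distributional K^poly under
randomized reductions, and HiraharaNanashima2026 (STOC 2026) gives a sharp characterization of
Pessiland (agnostic learning, factor ℓ/polylog ℓ vs O(ℓ)); HiraharaSanthanam2022 excludes
PH-Pessiland; BrzuskaCouteau2024 shows black-box constructions cannot even turn exponentially
average-case-hard NP into mild HoA of K^t.
- Ko1991 / Hirahara2018: MINKT ∉ P and (Gap)MINKT hardness — crux #5.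
- Worst-case → average-case inside NP by non-black-box reductions: Hirahara2018, STOC2021 (tree fact
hirahara_UP_DistNP), ChenHiraharaVafa2022.
Delta: no new mechanism is cla  [refs: 10.4230/lipics.itcs.2026.97, 2009.11514, doi:10.4230/lipics.itcs.2026.97, LiuPassFOCS2020, CCC1995, Impagliazzo2011, Wee2006, Hirahara2023, HiraharaNanashima2026, HiraharaSanthanam2022, BrzuskaCouteau2024, Ko1991, Hirahara2018, STOC2021, ChenHiraharaVafa2022]

Barriers (technique_class: meta-complexity, worst-case-to-average-case, non-black-box): BARRIERS (technique_class: meta-complexity, worst-case-to-average-case, non-black-box).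
- Literature.Barriers.PneNP.NPHardnessToOneWayFunctions (AGGM 2006 Thm 4; Bogdanov–Trevisan,
Feigenbaum–Fortnow): APPLIES to cruxes #3, #4 and #2 whenever one tries to get DistNP ⊄ AvgP, OWF or
HoA of K^t from NP-hardness by a non-adaptive black-box reduction — that forces coNP ⊆ AM(/poly).
Evasion: the line commits to NON-black-box reductions that use the code/running time of the
hypothetical heuristic (tree fact hirahara_UP_DistNP; Hirahara2023's characterization of OWF via
NP-hardness of distributional K^poly is explicitly "not subject to" these results,
ChenHiraharaVafa2022 §1.2); adaptive reductions are also outside Thm 4. Honest: no non-black-box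
argument reaches #2 or #4 today (BrzuskaCouteau2024 even separates mild HoA of K^t from
exponentially avg-hard NP in the black-box world); the bet is that K^t's self-referential structure
(a good heuristic is itself a short program) supplies one.
- Literature.Barriers.PneNP.MCSPKarpHardness (Murray–Williams 2017; Kabanets–Cai; Ko;
Hirahara–Watanabe): APPLIES to the natural feeder of #3 ("eliminate Heuristica by proving
GapMINKT/MCSP NP-hard", HuangIlangoRen2023 p.3) and to any attempt at #5 via NP-hardness of MINKT:
deterministic many-one NP-hardness of MCSP gives EXP ≠ ZPP, natural reductions give EXP ⊄ P/poly,
NP-hardness of MINKT-type problems must be non-relativizing (Ko1991) and cannot be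
oracle-independent under plausible assumptions.

History (route lifecycle, newest last):
- 2026-08-15T16:18:09Z · rev 4: restated MetacplxNoPessiland (stmt-PneNP-0125), Assembly (stmt-PneNP-0122) — route-repair (unit rbadge-PneNP-MetaCplx-cd729240-g2, 2026-08-15): GLUE CERTIFIED + REROUTE + rationale labels. (1) Deciding theorem: `theorem closes (hX : Meta (planner-rbadge-PneNP-MetaCplx-cd729240-g2-0)
- 2026-08-15T16:20:37Z · rev 5: restated MetacplxThesis (stmt-PneNP-0121), MetacplxNoPessiland (stmt-PneNP-10542) — route-repair follow-up (same unit): make the CONSTANT cone clean. After rev 4 the gate reported `staffable: NO — 1 unproved dep: Literature.Computability.Crypto (planner-rbadge-PneNP-MetaCplx-cd729240-g2-0)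
- 2026-08-16T02:17:19Z · AUTO-CRUX: 1 conjecture-grade item(s) promoted to crux (MetacplxThesis) — refuter vetting / tiering apply (operator:999:1362873)
- 2026-08-16T04:14:27Z · AUTO-CRUX (backfill): MetacplxThesis — hypotheses of the deciding theorem that nothing in the route derives are cruxes (operator:999:1085951)
- 2026-08-23T00:12:31Z · DORMANT — reconciler: no traction for 5.8 d (last activity item-evidence-added at 2026-08-17T04:52:04Z); parked, not closed — `ledger route dormant route-PneNP-MetaCplx - (operator:999:1472187)

sub-problem: PneNP · status: dormant · opened planner-PneNP-Survey-0 2026-08-13T06:07:04Z · rev 5 · ledger route-PneNP-MetaCplx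
GENERATED by the gate from the ledger (D-0016/17). Provers cite these decls: `theorem foo : Summit.PneNP.PneNP.Theses.MetaCplx.<Decl> := …` in Summits/PneNP/PneNP/Theorems/<Name>.lean.
-/

namespace Summit.PneNP.PneNP.Theses.MetaCplx

open scoped BigOperators Topology Manifold Classical MeasureTheory ProbabilityTheory Matrix InnerProductSpace ComplexConjugate ContinuousMap
open Filter Set Function TopologicalSpace MeasureTheory

attribute [summit_statement] _root_.PneNP

open Literature.PNP

-- earlier MetacplxThesis (stmt-PneNP-0121, replaced 2026-08-15T16:20:37Z -> stmt-PneNP-10656): retired by None — Literature.Computability.Cryptography.OWFExist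
/-- item stmt-PneNP-10656 · crux (kind.auto-crux: conjecture-grade) · rank 0 · open · by planner
why it might fail: OWFs may not exist even if P≠NP: Heuristica (DistNP ⊆ AvgP; oracle Impagliazzo2011) and Pessiland (NP hard on average, no OWF; oracle Wee2006) are both consistent with current knowledge (Hirahara2023 p.2), so X sits strictly above the summit and needs a non-relativizing, non-black-box proof.
sources: Goldreich2001, Def. 2.2.1 (p.51) and p.47 (open), LiuPassFOCS2020, Thm 1.1 (arXiv:2009.11514); decl Literature.Computability.Cryptography.OWFExist_iff_isMildlyHardOnAverage_liuPassKt_holds, decl Literature.Computability.Cryptography.OWFExist (OneWayFunctions.lean:279, := ∃ f, IsOneWay f — definitionally this statement), Impagliazzo2011 (doi:10.1109/ccc.2011.34), Wee2006 (doi:10.1007/11681878_22), Hirahara2023, §1 p.2 (doi:10.1145/3564246.3585130)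
[target] Route thesis X of PneNP/MetaCplx: (uniformly secure) one-way functions exist — some
polynomial-time f : {0,1}* → {0,1}* that every PPT algorithm inverts with negligible probability
[Goldreich2001, Def. 2.2.1]; by Liu–Pass 2020 Thm 1.1 equivalent to mild average-case hardness of
K^t (crux #2). Spelled out as ∃ f, IsOneWay f; equal to
Literature.Computability.Cryptography.OWFExist by Iff.rfl (meaning unchanged — restated only so that
the cite-tagged conjecture constant OWFExist is not a dependency of the route: the conjecture is the
target, not a leaned-on fact). -/
@[route_item "route-PneNP-MetaCplx", crux]
def MetacplxThesis : Prop :=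
  ∃ f : List Bool → List Bool, Literature.Computability.Cryptography.IsOneWay f

/-- item stmt-PneNP-0123 · crux · rank 2 · open · by planner
why it might fail: ↔ OWFExist per U is now PROVED in the tree (OWFExist_iff_isMildlyHardOnAverage_liuPassKt_holds, t=2X, ε=1; UniversalMachine.nonempty_holds): #2 fails iff OWFs do not exist — consistent today (Heuristica/Pessiland oracles Impagliazzo2011, Wee2006); needs a non-relativizing, non-black-box proof.
sources: LiuPassFOCS2020 (arXiv:2009.11514): Thm 1.1 (= Thm 3.1 (a)⇔(b)), §2.2 p.8 (K^t, U), §2.4 Def. 2.3 (mildly HoA), Thm 4.1, Thms 5.2/5.5/5.6, decl Literature.Computability.Cryptography.OWFExist_iff_isMildlyHardOnAverage_liuPassKt_holds (Cryptography/LiuPassMainTheorem.lean: the per-t form is PROVED in the tree, seen 2026-08-15) — supersedes the gen-2 sim-overhead caveat as far as the FORMAL statement goes, decl Literature.Computability.MetaComplexity.UniversalMachine.nonempty_holds (MetaComplexity/UniversalMachineProofs.lean): ∀U is not vacuous (replaces the old 'inhabitation unproved' source line), planner check 2026-08-15: SketchCheck.lean in run/sessions/planner-PneNP-route-PneNP-MetaCplx-0/folder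 proves ktMildlyHoa_iff_thesis : MetacplxKtMildlyHoa ↔ MetacplxThesis (lean check rc 0; axioms propext, Classical.choice, Quot.sound), Impagliazzo2011 (doi:10.1109/ccc.2011.34); Wee2006 (doi:10.1007/11681878_22): oracles for Heuristica / Pessiland, BrzuskaCouteau2024 p.2, p.12-13 (doi:10.1007/s00145-024-09518-1): black-box constructions cannot get mild HoA of K^t even from exponentially avg-hard NP
For every clocked efficient universal machine U, no PPT algorithm computes x ↦ K^{2|x|}(x) on a 1 -
1/p(n) fraction of uniformly random x (Liu–Pass 2020, Def. 2.3, Thm 1.1 with ε = 1, t = 2X).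
Equivalent to the thesis by the Literature fact OWFExist_iff_isMildlyHardOnAverage_liuPassKt; the
information-theoretic heart of the route. [sources: LiuPass2020] [route PneNP/MetaCplx, rank 2] -/
@[route_item "route-PneNP-MetaCplx"]
def MetacplxKtMildlyHoa : Prop :=
  ∀ U : Literature.Computability.MetaComplexity.UniversalMachine, Literature.Computability.Cryptography.IsMildlyHardOnAverage Computability.encodeNat (Literature.Computability.Cryptography.liuPassKt U (2 * Polynomial.X))

/-- item stmt-PneNP-0124 · crux · rank 3 · open · by planner
why it might fail: Heuristica may be real: Impagliazzo2011's oracle has NP worst-case hard yet DistNP ⊆ AvgP (no relativizing proof); non-adaptive black-box worst-to-avg reductions for NP force coNP ⊆ AM/poly (Bogdanov–Trevisan 2006); the non-black-box route (hirahara_UP_DistNP) needs UP ⊄ DTIME(2^{O(n/log n)}), open.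
sources: Impagliazzo2011 (doi:10.1109/ccc.2011.34), Bogdanov–Trevisan, SIAM J. Comput. 36 (2006), doi:10.1137/s0097539705446974, AkaviaEtAl2006, Thm 4; decl Literature.Barriers.PneNP.NPHardnessToOneWayFunctions, decl Literature.Computability.Cryptography.hirahara_UP_DistNP (Hirahara STOC 2021, Thm 1.6; acq-00213), ChenHiraharaVafa2022, Thm 2, HuangIlangoRen2023 p.3; decl Literature.Barriers.PneNP.MCSPKarpHardness
Some (NP, P-samplable) distributional problem has no errorless average-polynomial-time algorithm
(Impagliazzo 1995 §2; Bogdanov–Trevisan 2006 Ch. 2). Necessary for OWF; implies P ≠ NP via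
distClass_P_subset_AvgP; follows from UP ⊄ DTIME(2^{O(n/log n)}) by hirahara_UP_DistNP [STOC2021,
Thm 1.6]. [sources: CCC1995; BogdanovTrevisan2006; STOC2021] [route PneNP/MetaCplx, rank 3] -/
@[route_item "route-PneNP-MetaCplx"]
def MetacplxNoHeuristica : Prop :=
  ¬ Literature.Computability.MetaComplexity.DistNP ⊆ Literature.Computability.MetaComplexity.AvgP

-- earlier MetacplxNoPessiland (stmt-PneNP-0125, replaced 2026-08-15T16:18:09Z -> stmt-PneNP-10542): retired by None — Literature.Computability.Cryptography.NoPessiland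
-- earlier MetacplxNoPessiland (stmt-PneNP-10542, replaced 2026-08-15T16:20:37Z -> stmt-PneNP-10657): retired by None — ¬ (Literature.Computability.MetaComplexity.DistNP ⊆ Literature.Computability.MetaComplexity.AvgP) → Literature.Computability.Cryptography.OWFExist
/-- item stmt-PneNP-10657 · crux · rank 4 · open · by planner
why it might fail: Pessiland may be real: Wee2006's oracle has NP hard on average yet no OWF, so only non-relativizing, non-black-box proofs work; typed with errorless AvgP (stronger reading); only PH-Pessiland excluded (HiraharaSanthanam2022), Pessiland merely characterized (HiraharaNanashima2026).
sources: Wee2006 (doi:10.1007/11681878_22), CCC1995 §4 (Impagliazzo's worlds; acq-00209), decl Literature.Computability.Cryptography.NoPessiland (Sweep1.lean:209, definitionally equal), decl Literature.Computability.Cryptography.noPessilandHeur_of_noPessiland, HiraharaSanthanam2022 pp.1-3, Thms 17/27 (doi:10.4230/LIPIcs.ITCS.2022.85), HiraharaNanashima2026 §1 p.2 (doi:10.1145/3798129.3800755), Hirahara2023 §1 p.2 (doi:10.1145/3564246.3585130)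
[crux] no Pessiland (Impagliazzo 1995 §4, open): if some (NP, P-samplable) distributional problem
has no errorless average-polynomial-time algorithm then one-way functions exist — the bridge #3 → #0
(its conclusion is the target MetacplxThesis verbatim). Equal to
Literature.Computability.Cryptography.NoPessiland by Iff.rfl (meaning unchanged; typed unfolded so
the route imports no crypto sweep file and depends on no cite-tagged conjecture constant). -/
@[route_item "route-PneNP-MetaCplx"]
def MetacplxNoPessiland : Prop :=
  ¬ (Literature.Computability.MetaComplexity.DistNP ⊆ Literature.Computability.MetaComplexity.AvgP) → ∃ f : List Bool → List Bool, Literature.Computability.Cryptography.IsOneWay f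

/-- item stmt-PneNP-0126 · crux · rank 5 · open · by planner
why it might fail: False iff MINKT_U ∈ P for some admissible U, e.g. if P = NP (MINKT ∈ NP via polyTime). No route from P≠NP: NP-hardness of MINKT open since Ko1991, must be non-relativizing (Ko), unlikely via deterministic reductions (Hirahara CCC20 p.6); known only from OWF (K^t HoA, some poly t). ∀U = strong form.
sources: Ko1991 (SIAM J. Comput. 20; acq-00200), as reported in HuangIlangoRen2023 §4 p.12 and HiraharaSanthanam2022 p.2 ('NP-hardness of the unrelativized versions of MINKT and MCSP are long-standing open questions'), paper:doi-10-4230-lipics-ccc-2020-20 (Hirahara CCC 2020) p.6, p.17 Def 17, p.22 Prop 25 (MINKT ∈ NP), Hirahara2018 (doi:10.1109/focs.2018.00032); decl Literature.Computability.MetaComplexity.Hirahara2018_gapMINKT_mem_PromiseP, LiuPassFOCS2020 §2.2 and p.7 (OWF ⇒ K^t HoA for some polynomial t — the overhead-robust form — ⇒ MINKT ∉ P), decl Literature.Computability.MetaComplexity.UniversalMachine.MINKT; decl Literature.Barriers.PneNP.MCSPKarpHardness, refuter-refute-A-1 note: ONE-U vs ALL-U forms differ, ∀U is the strong one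
Ko's language {⟨x,1^t,1^s⟩ : K^t(x) ≤ s} is not polynomial-time decidable (Ko 1991; open). Implied
by the thesis; since MINKT ∈ NP (guess the program) it alone implies P ≠ NP — the weakest typed
statement on this line, filed so a refuter can attack the encoding conventions of UniversalMachine
early. [sources: Ko1991; LiuPass2020] [route PneNP/MetaCplx, rank 5] -/
@[route_item "route-PneNP-MetaCplx"]
def MetacplxMinktNotInP : Prop :=
  ∀ U : Literature.Computability.MetaComplexity.UniversalMachine, U.MINKT ∉ Literature.Computability.Complexity.Classes.P

-- earlier Assembly (stmt-PneNP-0122, replaced 2026-08-15T16:18:09Z -> stmt-PneNP-10543): retired by None — Literature.Computability.Cryptography.P_ne_NP_of_OWFExist → Literature.Computability.Complexity.P_bool_eq → Literature.Computability.Complexity.NP_bool_eq → Literature.Computability.Complexity.P_subset_NP → Literature.Computability.Cryptography.OWFExist → PneNP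
/-- item stmt-PneNP-10543 · assembly · rank 1 · closed · proved by Summit.PneNP.PneNP.Theorems.metaCplx_assembly_proof @ 5550490f3627 (prover) · by planner
Assembly for route MetaCplx (kept because the gate does not drop assembly items; superseded as the
deciding statement by the certified `closes`): the thesis X = OWFExist implies Cook's P ≠ NP over
the Wave0 classes — Goldreich 2001 §2.7.4 Exercise 2 (OWF ⇒ NP ⊄ P by search-to-decision) plus the
proved model bridges P_bool_eq_holds / np_bool_eq. Provable now: it is literally `fun hX => closes
hX` once the route file carries `closes`. [sources: Goldreich2001 §2.7.4 Ex. 2; CookClay2006 §1] -/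
@[route_item "route-PneNP-MetaCplx"]
def Assembly : Prop :=
  MetacplxThesis → _root_.PneNP

/-! D-0027 §2.1 — DECIDING THEOREM (planner-authored via `route open/edit --closes-file`; by planner-rbadge-PneNP-MetaCplx-cd729240-g2-0 2026-08-15T16:18:09Z):
its hypotheses are this route's items and its conclusion the sub-problem Statement (glue_lint), and it elaborates with this file. -/

/-- **Deciding theorem of route MetaCplx (D-0027 §2.1).** The thesis X = `MetacplxThesis`
(`OWFExist`: one-way functions exist, Goldreich 2001 Def. 2.2.1) implies Cook's `P ≠ NP` in the
registered shape `∃ L, L ∈ PNPWave0.NP Bool ∧ L ∉ PNPWave0.P Bool` (= `_root_.PneNP` by `rfl`).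
Proof (Goldreich 2001, §2.7.4 Exercise 2, assembled from tree theorems only): if `NP ⊆ P` then a
polynomial-time `f` has a polynomial-time sure inverter `g` (`exists_inverter_of_NP_subset_P`,
search-to-decision); the coin-free PPT algorithm `RandAlg.ofDet g` (`RandAlg.IsPolyTime.ofDet_holds`)
then inverts with probability `1` for every `n` (`RandAlg.pr_ofDet`), contradicting negligibility of
`invertProb f (ofDet g)` at exponent `0`; finally the proved model bridges `P_bool_eq_holds`
(`PNPWave0.P Bool = Classes.P`) and `np_bool_eq` (`PNPWave0.NP Bool = Nondeterministic.NP`) move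
`¬ (NP ⊆ P)` onto the Statement's classes. The other route items (#2–#5) reach the Statement
through X: #2 ↔ X (`OWFExist_iff_isMildlyHardOnAverage_liuPassKt_holds`), #3 ∧ #4 → X (by the
definition of #4), X → #5. -/
@[closes "route-PneNP-MetaCplx"] theorem closes (hX : MetacplxThesis) : _root_.PneNP := by
  classical
  -- Step 1 (Goldreich §2.7.4 Ex. 2): one-way functions give `NP ⊄ P` in the Classes/Nondeterministic model.
  have hNP : ¬ (Literature.Computability.Complexity.Nondeterministic.NP ⊆
      Literature.Computability.Complexity.Classes.P) := by
    intro hsub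
    obtain ⟨f, hf⟩ := hX
    obtain ⟨g, hg, hinv⟩ :=
      Literature.Computability.Complexity.exists_inverter_of_NP_subset_P hsub hf.1
    have hdecay := hf.2 (Literature.Computability.Complexity.RandAlg.ofDet g)
      (Literature.Computability.Complexity.RandAlg.IsPolyTime.ofDet_holds hg)
    have h1 : Literature.Computability.Cryptography.invertProb f
        (Literature.Computability.Complexity.RandAlg.ofDet g) = fun _ => (1 : ℝ) := by
      funext n
      unfold Literature.Computability.Cryptography.invertProb
        Literature.Computability.Cryptography.uniformAvg
      have h1' : ∀ x : List.Vector Bool n,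
          (Literature.Computability.Complexity.RandAlg.ofDet g).pr id
              (Literature.Computability.Complexity.boolPair (Computability.unaryEncodeNat n)
                (f x.toList)) {z | f z = f x.toList} = 1 := by
        intro x
        rw [Literature.Computability.Complexity.RandAlg.pr_ofDet, if_pos]
        exact (hinv n x.toList x.toList_length).2
      simp only [h1', Finset.sum_const, Finset.card_univ, card_vector, Fintype.card_bool,
        nsmul_eq_mul, mul_one]
      push_cast
      exact div_self (by positivity)
    rw [h1] at hdecay
    have h0 := hdecay 0
    simp only [pow_zero, one_mul] at h0
    exact one_ne_zero (tendsto_nhds_unique tendsto_const_nhds h0)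
  -- Step 2: the proved model bridges carry `NP ⊄ P` to Cook's Wave0 classes of the Statement.
  have hP : Literature.Computability.Complexity.PNPWave0.P Bool =
      Literature.Computability.Complexity.Classes.P :=
    Literature.Computability.Complexity.P_bool_eq_holds
  have hN : Literature.Computability.Complexity.PNPWave0.NP Bool =
      Literature.Computability.Complexity.Nondeterministic.NP :=
    Literature.Computability.Complexity.np_bool_eq
  show ∃ L : Language Bool, L ∈ Literature.Computability.Complexity.PNPWave0.NP Bool ∧
      L ∉ Literature.Computability.Complexity.PNPWave0.P Bool
  rw [hP, hN]
  simpa only [Set.not_subset] using hNP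

end Summit.PneNP.PneNP.Theses.MetaCplx
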